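import Summits.BirchSwinnertonDyer.BirchSwinnertonDyer.Theorems.KatoDescentTamePotSupersingularJetchevIrreducibleReadingThm52RowDataPB
import Summits.BirchSwinnertonDyer.BirchSwinnertonDyer.Theorems.Rank1ResidualJetThm63KernelInputs
import Summits.BirchSwinnertonDyer.BirchSwinnertonDyer.Theorems.KatoDescentTamePotSupersingularJetchevIrreducibleReadingThm52Bricks
import HarnessLib

/-!
# Crux `JetchevIrreducibleReadingByName` (item 20165, shared K8-t′ / K9) — S5 RE-KEY, layer 2/4 (KernelInputs): g9's
# `tamagawaExponent_le_mInfty_of_kernelInputs_of_irreducible_of_heegner` (p519470) with `h44I ↦ h47P`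

WHY (the S5 re-key, common to layers 0–4). Skeleton v6 of crux 20165 displays [McC] Prop. 4.4 in the irreducible reading
as the stub S5 `Sig.stub_prop44Irred` = a conjunction `(A) ∧ (B)` over ALL odd `p` with `E[p]` irreducible; every consumer
uses (B) only, (A) is a theorem on the rows (p530898), and every row has `p ∣ N_E` (additive `p`). The chain RowData →
KernelInputs → LocalFacts → NamedPrint (p517819 → p519470 → p525480 → p532411) threads the closed binder `h44I` (= S5
verbatim) down to the one adapter that uses it; this re-key threads instead the WEAKER closed binder `h47P` := S5 PRIMED
(`(p : ℤ) ∣ W.conductorNorm ℤ` after irreducibility, as S2′/S3′ in v5) and (B)-ONLY, so the planner can re-cut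
S5 ↦ `stub_prop47IrredP` := `h47P` (true on more ground; the shape cell `bsd-stepL`'s Zhang-currency port of x11b3's
`h44` programme + (A) delivers, labelled remainder Gross 1991 Prop. 3.7 (2)). Each layer is its predecessor BYTE-FOR-BYTE
with `h44I ↦ h47P` (and `hpN` fed to the adapter at the RowData layer); new namespace `…Theorems.JetchevIrreducibleH63P`,
theorem names suffixed `_of_prop47P`. Seat `bsd-potss-k8t-c4` g11; `--supports 20165`, helper; route-free; CONDITIONAL
throughout; nothing booked, no item closed, BSD is not proved by any of this.

WHAT IS PROVED. `tamagawaExponent_le_mInfty_of_kernelInputs_of_irreducible_of_heegner_of_prop47P`: statement and proof of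
p519470 verbatim except the first binder and the layer-1 call. References: [cite: Jetchev2008, Thm. 5.2 (p. 821), Prop. 4.9,
Thm. 5.1, Lemma 5.2, Rem. 6.2] [cite: McCallumLMS1991, §4 Prop. 4.4] [cite: GrossLMS1991, §3, Prop. 5.3] [cite: GrossZagier1986, III (3.1)].
-/


set_option autoImplicit false
-- the Theorems directory repeats the summit name (sibling precedent `KatoDescentPotSupersingularAssembly.lean`)
set_option linter.dupNamespace false

noncomputable section

open scoped Classical

open WeierstrassCurve IsDedekindDomain NumberField Literature.NumberTheory.EllipticCurves
  Literature.NumberTheory.EllipticCurves.ModularForms Literature.NumberTheory.EllipticCurves.Jetchev2008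
  Literature.NumberTheory.GaloisRepresentations
  Literature.NumberTheory.GaloisRepresentations.DiscreteGaloisModule
  Summit.BirchSwinnertonDyer.Rank1Residual.X11b
  Summit.BirchSwinnertonDyer.Rank1Residual.JET
  Summit.BirchSwinnertonDyer.BirchSwinnertonDyer.Theorems.JetchevIrreducibleReadingThm52Bricks

open Summit.BirchSwinnertonDyer.BirchSwinnertonDyer.Theorems.JetchevIrreducibleReadingThm52

namespace Summit.BirchSwinnertonDyer.BirchSwinnertonDyer.Theorems.JetchevIrreducibleH63P

/-- **[J] Thm 5.2 at a core vertex with the kernel bricks plugged in, for `E[p]` IRREDUCIBLE and `p ∣ N_E`,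
the Čebotarev reading DISCHARGED** — g8's `tamagawaExponent_le_mInfty_of_kernelInputs_of_irreducible` with the
binder `h32I` removed (the row theorem `tamagawaExponent_le_mInfty_of_rowData_of_irreducible_of_heegner` gets
[McC] Cor. 3.2 from the theorem `cor32_localOrder_of_irreducible_of_heegner`); everything else byte-for-byte.
Remaining inputs: named print `hCM1`, `hCM2`, `h53`, `hGZ`/`hcop′`, the reading `h44I` ([McC] Prop. 4.4),
kernel gaps `htr`, `hT`-reconciled structures, `hdual_q`, `hdual_ℓ`, `h49str`, `h49tr`. CONCLUSION: `t ≤ m_∞`.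
[cite: Jetchev2008, Thm. 5.2 (p. 821) and proof] [cite: McCallumLMS1991, §3 Cor. 3.2, §4 Prop. 4.4, §5 (p. 305)]
[cite: GrossLMS1991, Prop. 5.3, Prop. 5.4, Prop. 6.2 (1)] [cite: GrossZagier1986, III (3.1)] -/
theorem tamagawaExponent_le_mInfty_of_kernelInputs_of_irreducible_of_heegner_of_prop47P
    (h47P : ∀ (W : WeierstrassCurve ℚ) [W.IsElliptic] [W.IsGloballyMinimal] [NeZero (W.conductorNorm ℤ)],
        ¬ W.HasCM →
        ∀ (K : Type) [Field K] [NumberField K], IsImaginaryQuadratic K →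
        NumberField.discr K ≠ -3 → NumberField.discr K ≠ -4 →
        SatisfiesHeegnerHypothesis (W.conductorNorm ℤ) K →
        ∀ (p : ℕ) [Fact p.Prime], p ≠ 2 → W.HasIrreducibleModPGaloisRep p → (p : ℤ) ∣ W.conductorNorm ℤ →
        ∀ (Dt : ModularParametrizationData W (W.conductorNorm ℤ)) (β : ℤ) (ι : K →+* ℂ)
          (M : ℕ), 1 ≤ M →
        ∀ (m l : ℕ), Squarefree (m * l) → l.Prime → ¬ l ∣ m →
          (∀ l' ∈ (m * l).primeFactors, Zhang2014.IsKolyvaginPrime (W.conductorNorm ℤ) W K p l' ∧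
            M ≤ Zhang2014.kolyvaginIndex W p l') →
        ∀ (d : KolyvaginHeegnerData Dt β ι m) (d' : KolyvaginHeegnerData Dt β ι (m * l)),
          (∀ l' ∈ m.primeFactors, ∀ (x : ringClassField K ι m) (x' : ringClassField K ι (m * l)),
            (x : ℂ) = x' → ((d'.σ l' x' : ringClassField K ι (m * l)) : ℂ) = (d.σ l' x : ℂ)) →
          (∀ s ∈ d.S, ∃ s' ∈ d'.S, ∀ (x : ringClassField K ι m) (x' : ringClassField K ι (m * l)),
            (x : ℂ) = x' → ((s' x' : ringClassField K ι (m * l)) : ℂ) = (s x : ℂ)) →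
          (∀ s' ∈ d'.S, ∃ s ∈ d.S, ∀ (x : ringClassField K ι m) (x' : ringClassField K ι (m * l)),
            (x : ℂ) = x' → ((s' x' : ringClassField K ι (m * l)) : ℂ) = (s x : ℂ)) →
          (∀ (x : ringClassField K ι m) (x' : ringClassField K ι (m * l)),
            (x : ℂ) = x' → d'.emb x' = d.emb x) →
        ∀ (v : HeightOneSpectrum (𝓞 K)), (l : 𝓞 K) ∈ v.asIdeal →
        ∀ (j : ℕ),
          (((p ^ j : ℕ) : ℤ) • d'.kolyvaginClass (Fact.out : p.Prime) M ∈
              (W.baseChange K).torsionLocalKer (v.adicCompletion K) ((p ^ M : ℕ) : ℤ) ↔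
            ((p ^ j : ℕ) : ℤ) • d.kolyvaginClass (Fact.out : p.Prime) M ∈
              (W.baseChange K).torsionLocalKer (v.adicCompletion K) ((p ^ M : ℕ) : ℤ)))
    (W : WeierstrassCurve ℚ) [W.IsElliptic] [W.IsGloballyMinimal] [NeZero (W.conductorNorm ℤ)]
    (hcm : ¬ W.HasCM) (K : Type) [Field K] [NumberField K] (hK : IsImaginaryQuadratic K)
    (hD3 : NumberField.discr K ≠ -3) (hD4 : NumberField.discr K ≠ -4)
    (hH : SatisfiesHeegnerHypothesis (W.conductorNorm ℤ) K)
    (hCM1 : phi_heegnerPointOfConductor_mem_range_map_ringClassField (W.conductorNorm ℤ) W K)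
    (hCM2 : exists_generator_ringClassGalOver K)
    (p : ℕ) [Fact p.Prime] (hp2 : p ≠ 2) (hirr : W.HasIrreducibleModPGaloisRep p)
    (hpN : p ∣ W.conductorNorm ℤ)
    (Dt : ModularParametrizationData W (W.conductorNorm ℤ)) (β : ℤ) (ι : K →+* ℂ)
    [∀ j : ℕ, NumberField (ringClassField K ι j)]
    (τ : K ≃ₐ[ℚ] K) (hτ : τ ≠ 1)
    -- Gross Prop. 5.3 for the Fricke sign `ε` (cite-only named input)
    (ε : ℤ) (hε : ε = 1 ∨ ε = -1)
    (h53 : ∀ (m : ℕ) (dm : KolyvaginHeegnerData Dt β ι m)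
      (τm : ringClassField K ι m ≃ₐ[ℚ] ringClassField K ι m),
      (∀ x : ringClassField K ι m, ((τm x : ringClassField K ι m) : ℂ) = starRingEnd ℂ x) →
      ∃ σ' ∈ ringClassGal ι m, IsOfFinAddOrder
        (pointGalHom W (ringClassField K ι m) τm dm.y -
          ε • pointGalHom W (ringClassField K ι m) σ' dm.y))
    -- [GZ86 III (3.1)] in the receptacle form, with `n'` prime to `p` (cite-only named input)
    {n' : ℤ} (hcop' : IsCoprime (p : ℤ) n')
    (hGZ : ∀ (m : ℕ) (dm : KolyvaginHeegnerData Dt β ι m)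
      (γ : ringClassField K ι m ≃ₐ[ℚ] ringClassField K ι m), γ ∈ ringClassGal ι m →
      ∀ v : HeightOneSpectrum (𝓞 K), ¬ (W.baseChange K).HasGoodReductionAt v →
        n' • pointsMap (W.baseChange K) (v.adicCompletion K)
            (dm.toGeomPoints (pointGalHom W (ringClassField K ι m) γ dm.y)) ∈
          E0Receptacle (W.baseChange K) v ∧
        ∀ (ℓ : ℕ), ℓ ∈ m.primeFactors → ∀ (dm' : KolyvaginHeegnerData Dt β ι (m / ℓ))
          (hle : ringClassField K ι (m / ℓ) ≤ ringClassField K ι m),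
          n' • pointsMap (W.baseChange K) (v.adicCompletion K)
              (dm.toGeomPoints (pointGalHom W (ringClassField K ι m) γ
                (WeierstrassCurve.Affine.Point.map (W' := W)
                  ((RingClassField.inclusion ι hle).restrictScalars ℚ) dm'.y))) ∈
            E0Receptacle (W.baseChange K) v)
    -- the `H63` binder's bookkeeping: `mdiv`, `m`, the level `k`, the core vertex `c`, `m(c) = m_∞`
    (mdiv m : {c : ℕ // Squarefree c ∧ ∀ ℓ ∈ c.primeFactors,
        Zhang2014.IsKolyvaginPrime (W.conductorNorm ℤ) W K p ℓ} → ℕ∞)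
    (hmdiv : ∀ c (u : ℕ), (u : ℕ∞) ≤ mdiv c ↔ ∀ d : KolyvaginHeegnerData Dt β ι c.1,
      ∃ Q : (W.baseChange (ringClassField K ι c.1)).toAffine.Point,
        ((p ^ u : ℕ) : ℤ) • Q = d.derivedPoint)
    (hm : ∀ c, m c = if mdiv c < Zhang2014.levelIndex W p c.1 then mdiv c else ⊤)
    (k : ℕ) (c : {c : ℕ // Squarefree c ∧ ∀ ℓ ∈ c.primeFactors,
        Zhang2014.IsKolyvaginPrime (W.conductorNorm ℤ) W K p ℓ}) (hk : 1 ≤ k)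
    (hcore : IsGlobalCoreVertex W K ι τ p k c.1) (mInf : ℕ) (hmc : m c = mInf)
    (hkM : (k : ℕ∞) + mInf ≤ Zhang2014.levelIndex W p c.1)
    (t : ℕ) (htk : t < k) (hik : mInf < k)
    -- the structures (parameters): local transverse family, stringent family, carrier places, dual module
    (𝒯 𝒮 : SelmerStructure ((W.baseChange K).torsionGaloisModule ((p ^ k : ℕ) : ℤ)))
    (hT : ∀ x : galoisCohomology ((W.baseChange K).torsionGaloisModule ((p ^ k : ℕ) : ℤ)) 1,
      (∀ w ∈ placesDividing K c.1,
        galoisCohomology.localization ((W.baseChange K).torsionGaloisModule ((p ^ k : ℕ) : ℤ))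
          (Sum.inr w) 1 x ∈ 𝒯 (Sum.inr w)) ↔
      ∀ ℓ ∈ c.1.primeFactors, x ∈ transverseKer W K ι ((p ^ k : ℕ) : ℤ) ℓ)
    (hS : ∀ v, 𝒮 v ≤ (W.baseChange K).kummerSelmerStructure ((p ^ k : ℕ) : ℤ) v)
    (Qcar : Finset (HeightOneSpectrum (𝓞 K))) (hQcar : Disjoint Qcar (placesDividing K c.1))
    (e' : ℤ) (he' : e' = ε * (-1) ^ c.1.primeFactors.card)
    (C' : AddSubgroup (galH1Torsion (W.baseChange K) ((p ^ k : ℕ) : ℤ)))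
    (hC : C' ≤ signPart W K τ ((p ^ k : ℕ) : ℤ) (-e') ⊤)
    -- KERNEL GAP (S2/S10): the transverse condition of `c_k(c)` at the primes of `c`
    (htr : ∀ (d : KolyvaginHeegnerData Dt β ι c.1), ∀ ℓ ∈ c.1.primeFactors,
      (d.kolyvaginClass (Fact.out : p.Prime) k :
        galoisCohomology ((W.baseChange K).torsionGaloisModule ((p ^ k : ℕ) : ℤ)) 1) ∈
        transverseKer W K ι ((p ^ k : ℕ) : ℤ) ℓ)
    -- KERNEL GAP (S1/S3): Thm 5.1 at the carrier + (δ)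
    (hdual_q : ∃ (Qg Qg' : Type) (_ : AddCommGroup Qg) (_ : AddCommGroup Qg') (_ : Finite Qg')
      (locq : signPart W K τ ((p ^ k : ℕ) : ℤ) (-e')
        (modifiedSelmerGroup W K ι ((p ^ k : ℕ) : ℤ) c.1) →+ Qg)
      (locq' : C' →+ Qg'),
      (∀ x : C', locq' x = 0 ↔ (x : galH1Torsion (W.baseChange K) ((p ^ k : ℕ) : ℤ)) ∈
        signPart W K τ ((p ^ k : ℕ) : ℤ) (-e') (modifiedSelmerGroup W K ι ((p ^ k : ℕ) : ℤ) c.1)) ∧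
      Nat.card locq.range * Nat.card locq'.range = Nat.card Qg' ∧ IsAddCyclic Qg' ∧ Nat.card Qg' = p ^ t)
    -- KERNEL GAPS (S6/S10): Prop 4.9♯ for the classes at `cℓ` — STRINGENT part at the carrier places
    -- (Jetchev's Prop. 4.9 proper: the x11b3 layer theorem at `v ∣ p` / Lemma 4.3 at `q ≠ p`) and
    -- TRANSVERSE part at the primes of `c`; the sign and Kummer parts are discharged below
    (h49str : ∀ (ℓ : ℕ), Zhang2014.IsKolyvaginPrime (W.conductorNorm ℤ) W K p ℓ →
      k ≤ Zhang2014.kolyvaginIndex W p ℓ → ℓ ∉ c.1.primeFactors →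
      ∀ (d' : KolyvaginHeegnerData Dt β ι (c.1 * ℓ)), ∀ q ∈ Qcar,
      galoisCohomology.localization ((W.baseChange K).torsionGaloisModule ((p ^ k : ℕ) : ℤ))
          (Sum.inr q) 1 (d'.kolyvaginClass (Fact.out : p.Prime) k) ∈ 𝒮 (Sum.inr q))
    (h49tr : ∀ (ℓ : ℕ), Zhang2014.IsKolyvaginPrime (W.conductorNorm ℤ) W K p ℓ →
      k ≤ Zhang2014.kolyvaginIndex W p ℓ → ℓ ∉ c.1.primeFactors →
      ∀ (d' : KolyvaginHeegnerData Dt β ι (c.1 * ℓ)), ∀ w ∈ placesDividing K c.1,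
      galoisCohomology.localization ((W.baseChange K).torsionGaloisModule ((p ^ k : ℕ) : ℤ))
          (Sum.inr w) 1 (d'.kolyvaginClass (Fact.out : p.Prime) k) ∈ 𝒯 (Sum.inr w))
    -- KERNEL GAP (S1): Thm 5.1 / Lemma 5.2 (iii) at `λ`
    (hdual_ℓ : ∀ (ℓ : ℕ), Zhang2014.IsKolyvaginPrime (W.conductorNorm ℤ) W K p ℓ →
      k ≤ Zhang2014.kolyvaginIndex W p ℓ → ℓ ∉ c.1.primeFactors →
      ∀ (v : HeightOneSpectrum (𝓞 K)), (ℓ : 𝓞 K) ∈ v.asIdeal →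
      ∃ (Sg : Type) (_ : AddCommGroup Sg)
        (sing : signPart W K τ ((p ^ k : ℕ) : ℤ) (-e')
          (((selmerF0 W ((p ^ k : ℕ) : ℤ) 𝒯 𝒮 (placesDividing K c.1) Qcar).relaxedAt {v}).selmerGroup) →+ Sg),
        (∀ x, sing x = 0 ↔ (x : galoisCohomology ((W.baseChange K).torsionGaloisModule ((p ^ k : ℕ) : ℤ)) 1) ∈
          signPart W K τ ((p ^ k : ℕ) : ℤ) (-e')
            ((selmerF0 W ((p ^ k : ℕ) : ℤ) 𝒯 𝒮 (placesDividing K c.1) Qcar).selmerGroup)) ∧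
        Nat.card sing.range *
          Nat.card (C'.map (galoisCohomology.localization
            ((W.baseChange K).torsionGaloisModule ((p ^ k : ℕ) : ℤ)) (Sum.inr v) 1 :
              galH1Torsion (W.baseChange K) ((p ^ k : ℕ) : ℤ) →+ _)) = p ^ k) :
    t ≤ mInf := by
  have hp : p.Prime := Fact.out
  have hD : NumberField.discr K < -4 := KolyvaginAssembly.discr_lt_neg_four hK ⟨hD3, hD4⟩
  -- level bookkeeping: `k ≤ M(c)`, hence `k ≤ M(ℓ)` at the primes of `c`
  have hkc : (k : ℕ∞) ≤ Zhang2014.levelIndex W p c.1 := le_trans le_self_add hkM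
  have hcK : ∀ ℓ ∈ c.1.primeFactors, Zhang2014.IsKolyvaginPrime (W.conductorNorm ℤ) W K p ℓ ∧
      k ≤ Zhang2014.kolyvaginIndex W p ℓ := fun ℓ hℓ ↦
    ⟨c.2.2 ℓ hℓ, Zhang2014.natCast_le_levelIndex_iff.mp hkc ℓ hℓ⟩
  -- (S7) the datum `d` of conductor `c` with `p^{m_∞} ∥ P_c`, `ord c_k(c) = p^{k − m_∞}`, `c_k(c) ≠ 0`
  obtain ⟨d, -, -, hordκ, hκ0⟩ := exists_datum_addOrderOf_kolyvaginClass_of_m_eq_of_irreducible hCM1 hCM2 hK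
    hD3 hD4 hH hp2 hirr hpN Dt β ι mdiv m hmdiv hm c mInf k hmc hik hkc
  -- (sign) Gross Prop 5.4: `τ c_k(c) = e' c_k(c)`, `e' = ε(−1)^r ∈ {±1}`
  obtain ⟨he, hκsign⟩ := exists_sign_conjAct_kolyvaginClass_of_prop53_of_irreducible hCM1 hCM2 hK hD3 hD4
    hH hp2 hirr hpN τ hτ Dt β ι ε hε h53 c.2.1 hk hcK d
  rw [← he'] at he hκsign
  -- (Selmer membership) Kummer part by Gross 6.2 (1) mod GZ31, transverse part = the gap `htr`
  have hκsel : d.kolyvaginClass hp k ∈ modifiedSelmerGroup W K ι ((p ^ k : ℕ) : ℤ) c.1 :=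
    (mem_modifiedSelmerGroup_iff W K ι ((p ^ k : ℕ) : ℤ) c.1 _).mpr
      ⟨fun v hv ↦ localization_kolyvaginClass_mem_kummerSelmerStructure_of_GZ31_of_irreducible hCM1 hCM2
        hK hD3 hD4 hH hp2 hirr hpN Dt β ι hcop' hGZ c.2.1 hcK d v hv, htr d⟩
  -- (compatible data at `cℓ`) from the CM fact
  obtain ⟨dℓ, hdℓ⟩ := exists_compatible_data_of_grossCM hCM1 hK hD hH p Dt β ι c.2.1
    (fun ℓ hℓ ↦ c.2.2 ℓ hℓ) d
  -- (Prop 4.9♯ at `cℓ`) sign and Kummer parts discharged; stringent + transverse = the gaps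
  have hc0 : c.1 ≠ 0 := c.2.1.ne_zero
  have h49 : ∀ (ℓ : ℕ) (h1 : Zhang2014.IsKolyvaginPrime (W.conductorNorm ℤ) W K p ℓ)
      (h2 : k ≤ Zhang2014.kolyvaginIndex W p ℓ) (h3 : ℓ ∉ c.1.primeFactors)
      (v : HeightOneSpectrum (𝓞 K)), (ℓ : 𝓞 K) ∈ v.asIdeal →
      (dℓ ℓ h1 h3).kolyvaginClass hp k ∈
        signPart W K τ ((p ^ k : ℕ) : ℤ) (-e')
          (((selmerF0 W ((p ^ k : ℕ) : ℤ) 𝒯 𝒮 (placesDividing K c.1) Qcar).relaxedAt {v}).selmerGroup) := by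
    intro ℓ h1 h2 h3 v hv
    have hl : ℓ.Prime := h1.1
    have hlc : ¬ ℓ ∣ c.1 := fun h ↦ h3 (Nat.mem_primeFactors.mpr ⟨hl, h, hc0⟩)
    have hcl : Squarefree (c.1 * ℓ) :=
      (Nat.squarefree_mul ((Nat.Prime.coprime_iff_not_dvd hl).mpr hlc).symm).mpr ⟨c.2.1, hl.squarefree⟩
    have hpf : (c.1 * ℓ).primeFactors = c.1.primeFactors ∪ {ℓ} := by
      rw [Nat.primeFactors_mul hc0 hl.ne_zero, hl.primeFactors]
    have hcKℓ : ∀ l' ∈ (c.1 * ℓ).primeFactors, Zhang2014.IsKolyvaginPrime (W.conductorNorm ℤ) W K p l' ∧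
        k ≤ Zhang2014.kolyvaginIndex W p l' := by
      intro l' hl'
      rw [hpf, Finset.mem_union, Finset.mem_singleton] at hl'
      rcases hl' with h | rfl
      · exact hcK l' h
      · exact ⟨h1, h2⟩
    -- the sign at `cℓ`: `ε(−1)^{r+1} = −e'`
    obtain ⟨-, hsignℓ⟩ := exists_sign_conjAct_kolyvaginClass_of_prop53_of_irreducible hCM1 hCM2 hK hD3
      hD4 hH hp2 hirr hpN τ hτ Dt β ι ε hε h53 hcl hk hcKℓ (dℓ ℓ h1 h3)
    have hcard : (c.1 * ℓ).primeFactors.card = c.1.primeFactors.card + 1 := by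
      rw [hpf, Finset.card_union_of_disjoint (Finset.disjoint_singleton_right.mpr h3),
        Finset.card_singleton]
    rw [hcard, pow_succ, ← mul_assoc, ← he', mul_neg_one] at hsignℓ
    refine mem_signPart_relaxedAt_selmerF0 W τ _ (-e') 𝒯 𝒮 hc0 Qcar v _ hsignℓ ?_
      (fun q hq _ ↦ h49str ℓ h1 h2 h3 (dℓ ℓ h1 h3) q hq)
      (fun w hw _ _ ↦ h49tr ℓ h1 h2 h3 (dℓ ℓ h1 h3) w hw)
    -- the Kummer part: Gross 6.2 (1) mod GZ31 at level `cℓ`, at every place not over `cℓ`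
    intro w hwc hwv _
    refine localization_kolyvaginClass_mem_kummerSelmerStructure_of_GZ31_of_irreducible hCM1 hCM2 hK hD3
      hD4 hH hp2 hirr hpN Dt β ι hcop' hGZ hcl hcKℓ (dℓ ℓ h1 h3) w fun l' hl' hP ↦ ?_
    rw [hpf, Finset.mem_union, Finset.mem_singleton] at hl'
    rcases hl' with h | rfl
    · exact hwc l' h hP
    · obtain ⟨q, rfl, hq⟩ := hP
      exact hwv (congrArg Sum.inr
        (HeightOneSpectrum.eq_of_natCast_mem_of_isPrime_span h1.1 h1.2.2.2.2.1 hq hv))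
  -- assemble through the row theorem (Cor 3.2 in the irreducible reading PROVED, g9)
  exact tamagawaExponent_le_mInfty_of_rowData_of_irreducible_of_heegner_of_prop47P h47P W hcm K hK hD3 hD4 hH p hp2 hirr
    hpN Dt β ι τ hτ k t mInf hk htk hik c.1 c.2.1 hcK hcore e' he d
    hκsel hκsign hκ0 hordκ 𝒯 𝒮 hT hS Qcar hQcar C' hC hdual_q (fun ℓ h1 _ h3 ↦ dℓ ℓ h1 h3)
    (fun ℓ h1 _ h3 ↦ hdℓ ℓ h1 h3) h49 hdual_ℓ


end Summit.BirchSwinnertonDyer.BirchSwinnertonDyer.Theorems.JetchevIrreducibleH63P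

end
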